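import Summits.CriticalPhenomena.CardyFormulaZ2.Theorems.CardyBoundaryCoulombGasHalfPlaneMarkDensityLawWindowBelowOne

/-!
# `HalfPlaneMarkDensityLaw` (crux stmt-CriticalPhenomena-5661), line `Sketch`, cycle 4 (Positivity):
# glue Q9' — counting (Q3) + decoupling (Q8) + below-one give `liminf_n n·P[E_n(a,b,c,x)] > 0`

Fix `a < b < c < x`.  `Window.stub_eventually_le_one_sub` at `(a,b,c,x)` gives `c₁ > 0` with
`P[A_n ↔ [⌊cn⌋,⌊xn⌋]×{0} in H] ≤ 1 − c₁` eventually; Q3 at `(a,b,x)` gives `c₀ > 0` with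
`n · P[NL(⌊xn⌋; ⌊an⌋, ⌊bn⌋)] ≥ c₀` eventually.  For large `n` apply Q8 with `k = ⌊xn⌋`, `lo = ⌊an⌋`,
`hi = ⌊bn⌋`, `cl = ⌊cn⌋`, `q = 1 − c₁`: every escape crossing
`{(t,⌊bn⌋]×{0} ↔ [⌊cn⌋,⌊xn⌋)×{0} in H}`, `t ≥ ⌊an⌋`, is contained in `{A_n ↔ [⌊cn⌋,⌊xn⌋]×{0} in H}`
(`openCrossing_mono`), so has probability `≤ 1 − c₁`.  Hence
`c₁ · P[NL] ≤ P[firstHit H A_n ⌊cn⌋ ⌊xn⌋] = P[E_n]` (`markEvent_eq_firstHit`), and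
`lawSeq a b c x n = n · P[E_n] ≥ c₁ · (n · P[NL]) ≥ c₁ c₀ > 0`.
-/

noncomputable section

namespace Summit.CriticalPhenomena.CardyFormulaZ2.Cruxes.HalfPlaneMarkDensityLaw.SketchLine

open Literature.Probability.Percolation Literature.Probability.LatticeModels
open MeasureTheory Filter Set SimpleGraph
open scoped Topology
open Summit.CriticalPhenomena.CardyFormulaZ2.Theorems.HalfPlaneMarkDensityLaw.Negative

namespace Positivity

/-- STUB Q9' (glue): Q3, Q8 and `Window.stub_eventually_le_one_sub` give the positivity of the mark density. [folklore] -/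
theorem stub_densityPositivity_of :
    (∀ (a b x : ℝ), a < b → b < x → ∃ c₀ : ℝ, 0 < c₀ ∧ ∀ᶠ n : ℕ in atTop,
      c₀ ≤ (n : ℝ) * μ.real {ω : BondConfig (Site 2) | ∃ t : ℤ, ⌊a * n⌋ ≤ t ∧ t ≤ ⌊b * n⌋ ∧ ω ∈ openConnIn halfPlane (bpt (⌊x * n⌋)) (bpt t) ∧ ∀ s : ℤ, t < s → s < ⌊x * n⌋ → ω ∉ openConnIn halfPlane (bpt (⌊x * n⌋)) (bpt s)}) →
    (∀ (k lo hi cl : ℤ) (q : ℝ), lo ≤ hi → hi < cl → cl ≤ k →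
      (∀ t : ℤ, lo ≤ t → t ≤ hi → μ.real (openCrossing halfPlane (rowIcc (t + 1) hi) (rowIcc cl (k - 1))) ≤ q) →
      (1 - q) * μ.real {ω : BondConfig (Site 2) | ∃ t : ℤ, lo ≤ t ∧ t ≤ hi ∧ ω ∈ openConnIn halfPlane (bpt (k)) (bpt t) ∧ ∀ s : ℤ, t < s → s < k → ω ∉ openConnIn halfPlane (bpt (k)) (bpt s)} ≤
        μ.real (firstHit halfPlane (rowIcc lo hi) cl k)) →
    ∀ (a b c x : ℝ), a < b → b < c → c < x → ∃ c₁ : ℝ, 0 < c₁ ∧ ∀ᶠ n : ℕ in atTop, c₁ ≤ lawSeq a b c x n := by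
  intro hQ3 hQ8 a b c x hab hbc hcx
  obtain ⟨c₁, hc₁, hW⟩ := Window.stub_eventually_le_one_sub a b c x hab hbc hcx
  obtain ⟨c₀, hc₀, hN⟩ := hQ3 a b x hab (hbc.trans hcx)
  refine ⟨c₁ * c₀, mul_pos hc₁ hc₀, ?_⟩
  filter_upwards [hW, hN, Window.eventually_floor_add_two_le hbc, Window.eventually_floor_add_two_le hcx]
    with n hWn hNn e1 e2
  -- the four lattice marks at scale `n`
  have hlohi : ⌊a * (n : ℝ)⌋ ≤ ⌊b * (n : ℝ)⌋ :=
    Int.floor_le_floor (mul_le_mul_of_nonneg_right hab.le (Nat.cast_nonneg n))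
  have hhicl : ⌊b * (n : ℝ)⌋ < ⌊c * (n : ℝ)⌋ := by omega
  have hclk : ⌊c * (n : ℝ)⌋ ≤ ⌊x * (n : ℝ)⌋ := by omega
  -- every off-cluster escape crossing is contained in the four-arc crossing event `{A_n ↔ [⌊cn⌋,⌊xn⌋]×{0}}`
  have hesc : ∀ t : ℤ, ⌊a * (n : ℝ)⌋ ≤ t → t ≤ ⌊b * (n : ℝ)⌋ →
      μ.real (openCrossing halfPlane (rowIcc (t + 1) ⌊b * (n : ℝ)⌋)
        (rowIcc ⌊c * (n : ℝ)⌋ (⌊x * (n : ℝ)⌋ - 1))) ≤ 1 - c₁ := by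
    intro t ht₁ _
    refine le_trans (measureReal_mono ?_ (measure_ne_top _ _)) hWn
    refine openCrossing_mono subset_rfl ?_ ?_
    · intro v hv
      simp only [rowIcc, arcA, Set.mem_setOf_eq] at hv ⊢
      omega
    · intro v hv
      simp only [rowIcc, Set.mem_setOf_eq] at hv ⊢
      omega
  -- decoupling (Q8) with `q = 1 − c₁`
  have h8 := hQ8 ⌊x * (n : ℝ)⌋ ⌊a * (n : ℝ)⌋ ⌊b * (n : ℝ)⌋ ⌊c * (n : ℝ)⌋ (1 - c₁) hlohi hhicl hclk hesc
  rw [sub_sub_cancel] at h8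
  -- read back: `lawSeq a b c x n = n · P[firstHit H A_n ⌊cn⌋ ⌊xn⌋]` (definitional)
  have hlaw : lawSeq a b c x n =
      (n : ℝ) * μ.real (firstHit halfPlane (rowIcc ⌊a * (n : ℝ)⌋ ⌊b * (n : ℝ)⌋) ⌊c * (n : ℝ)⌋ ⌊x * (n : ℝ)⌋) := rfl
  rw [hlaw]
  have hn0 : (0 : ℝ) ≤ n := Nat.cast_nonneg n
  calc c₁ * c₀ ≤ c₁ * ((n : ℝ) * μ.real {ω : BondConfig (Site 2) | ∃ t : ℤ, ⌊a * (n : ℝ)⌋ ≤ t ∧ t ≤ ⌊b * (n : ℝ)⌋ ∧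
          ω ∈ openConnIn halfPlane (bpt (⌊x * (n : ℝ)⌋)) (bpt t) ∧
          ∀ s : ℤ, t < s → s < ⌊x * (n : ℝ)⌋ → ω ∉ openConnIn halfPlane (bpt (⌊x * (n : ℝ)⌋)) (bpt s)}) :=
        mul_le_mul_of_nonneg_left hNn hc₁.le
    _ = (n : ℝ) * (c₁ * μ.real {ω : BondConfig (Site 2) | ∃ t : ℤ, ⌊a * (n : ℝ)⌋ ≤ t ∧ t ≤ ⌊b * (n : ℝ)⌋ ∧
          ω ∈ openConnIn halfPlane (bpt (⌊x * (n : ℝ)⌋)) (bpt t) ∧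
          ∀ s : ℤ, t < s → s < ⌊x * (n : ℝ)⌋ → ω ∉ openConnIn halfPlane (bpt (⌊x * (n : ℝ)⌋)) (bpt s)}) := by
        ring
    _ ≤ (n : ℝ) * μ.real (firstHit halfPlane (rowIcc ⌊a * (n : ℝ)⌋ ⌊b * (n : ℝ)⌋) ⌊c * (n : ℝ)⌋ ⌊x * (n : ℝ)⌋) :=
        mul_le_mul_of_nonneg_left h8 hn0

end Positivity

end Summit.CriticalPhenomena.CardyFormulaZ2.Cruxes.HalfPlaneMarkDensityLaw.SketchLine
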